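import Mathlib

/-!
# Taylor-model arithmetic in the swirl parameter: the two inequalities (K23)

Solo seat `solo-NavierStokesRegularity-informed`, session 13; companion of
`paper/swirling-cone-linearisation.md` §5f (Proposition 11‴). The b-interval certificates represent every
quantity as a polynomial `∑_{k ≤ d} a_k s^k` in `s = b - b₀`, `|s| ≤ δ`, with ball-valued coefficients, and rest on
two elementary inequalities, certified here:

* `taylorModel_inv_remainder`: the remainder of the truncated geometric series used for inversion,
  `‖(1 + u)⁻¹ - ∑_{n < N} (-u)^n‖ ≤ μ^N / (1 - μ)` whenever `‖u‖ ≤ μ < 1`;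
* `taylorModel_lower_bound`: the lower bound used to certify that a minor / the flux does not vanish on the
  whole parameter interval, `‖c₀‖ - r₀ - ∑_{1 ≤ k ≤ d} A_k δ^k ≤ ‖∑_{k ≤ d} a_k s^k‖` when `‖a₀ - c₀‖ ≤ r₀`,
  `‖a_k‖ ≤ A_k` and `‖s‖ ≤ δ`.
No new definitions; axioms: standard.
-/

namespace Summit.NavierStokesRegularity.NavierStokesRegularity.Theorems

open Finset

/-- Inversion remainder of Taylor-model arithmetic: for `‖u‖ ≤ μ < 1` and every truncation order `N`,
`‖(1 + u)⁻¹ - ∑_{n < N} (-u)^n‖ ≤ μ ^ N / (1 - μ)` (indeed the difference equals `(-u)^N (1 + u)⁻¹` and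
`‖1 + u‖ ≥ 1 - μ`). -/
theorem taylorModel_inv_remainder {u : ℂ} {μ : ℝ} (hu : ‖u‖ ≤ μ) (hμ : μ < 1) (N : ℕ) :
    ‖(1 + u)⁻¹ - ∑ n ∈ range N, (-u) ^ n‖ ≤ μ ^ N / (1 - μ) := by
  have hμ0 : 0 ≤ μ := le_trans (norm_nonneg u) hu
  have hlow : 1 - μ ≤ ‖1 + u‖ := by
    have h := norm_sub_le (1 + u) u
    simp only [add_sub_cancel_right, norm_one] at h
    linarith
  have hpos : 0 < ‖1 + u‖ := lt_of_lt_of_le (by linarith) hlow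
  have hne : 1 + u ≠ 0 := norm_pos_iff.mp hpos
  have hg : (1 - (-u)) * ∑ n ∈ range N, (-u) ^ n = 1 - (-u) ^ N := mul_neg_geom_sum (-u) N
  have key : (1 + u)⁻¹ - ∑ n ∈ range N, (-u) ^ n = (-u) ^ N * (1 + u)⁻¹ := by
    have h2 : ∑ n ∈ range N, (-u) ^ n = (1 - (-u) ^ N) * (1 + u)⁻¹ := by
      rw [sub_neg_eq_add] at hg
      field_simp
      linear_combination hg
    rw [h2]
    field_simp
    ring
  rw [key, norm_mul, norm_pow, norm_neg, norm_inv, div_eq_mul_inv]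
  apply mul_le_mul (pow_le_pow_left₀ (norm_nonneg _) hu N) _ (by positivity) (by positivity)
  exact inv_anti₀ (by linarith) hlow

/-- Enclosure lower bound of Taylor-model arithmetic: if `‖s‖ ≤ δ`, the constant coefficient satisfies
`‖a 0 - c₀‖ ≤ r₀` and the higher coefficients `‖a (k+1)‖ ≤ A (k+1)` for `k < d`, then
`‖c₀‖ - r₀ - ∑_{k < d} A (k+1) δ^(k+1) ≤ ‖∑_{k < d+1} a k s^k‖`. (With `>` 0 on the left this certifies that the
polynomial does not vanish for any admissible `s`.) -/
theorem taylorModel_lower_bound (d : ℕ) (a : ℕ → ℂ) (c₀ s : ℂ) (r₀ δ : ℝ) (A : ℕ → ℝ)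
    (hs : ‖s‖ ≤ δ) (h0 : ‖a 0 - c₀‖ ≤ r₀) (hk : ∀ k, k < d → ‖a (k + 1)‖ ≤ A (k + 1)) :
    ‖c₀‖ - r₀ - ∑ k ∈ range d, A (k + 1) * δ ^ (k + 1) ≤ ‖∑ k ∈ range (d + 1), a k * s ^ k‖ := by
  have hδ : 0 ≤ δ := le_trans (norm_nonneg s) hs
  rw [sum_range_succ']
  simp only [pow_zero, mul_one]
  set R := ∑ k ∈ range d, a (k + 1) * s ^ (k + 1) with hR
  -- the tail is bounded by the majorant sum
  have hRle : ‖R‖ ≤ ∑ k ∈ range d, A (k + 1) * δ ^ (k + 1) := by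
    calc ‖R‖ ≤ ∑ k ∈ range d, ‖a (k + 1) * s ^ (k + 1)‖ := norm_sum_le _ _
      _ ≤ ∑ k ∈ range d, A (k + 1) * δ ^ (k + 1) := by
        apply sum_le_sum
        intro k hk'
        rw [norm_mul, norm_pow]
        have hk'' := hk k (mem_range.mp hk')
        apply mul_le_mul hk'' (pow_le_pow_left₀ (norm_nonneg _) hs _) (by positivity)
        exact le_trans (norm_nonneg _) hk''
  -- the constant coefficient is within r₀ of c₀
  have h0' : ‖c₀‖ - r₀ ≤ ‖a 0‖ := by
    have h := norm_sub_norm_le c₀ (a 0)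
    rw [norm_sub_rev] at h0
    linarith
  -- reverse triangle inequality
  have htri : ‖a 0‖ - ‖R‖ ≤ ‖R + a 0‖ := by
    have h := norm_sub_le (R + a 0) R
    simp only [add_sub_cancel_left] at h
    linarith
  linarith

end Summit.NavierStokesRegularity.NavierStokesRegularity.Theorems
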